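import Summits.CriticalPhenomena.PercolationContinuityZ3.Theorems.PercNearOneGluingAdditiveGluingQ9Line
import Summits.CriticalPhenomena.PercolationContinuityZ3.Theorems.PercNearOneGluingAdditiveGluingBlockGoodLeaves
import HarnessLib

/-!
# Line `starpeel` — EDGE-PEELING DERIVATIONS of block goodness at a FIXED designation (control-strategist g4, 2026-08-17)

Crux (FIXED, by name): `Summit.CriticalPhenomena.PercolationContinuityZ3.Theses.PercNearOneGluing.AdditiveGluing`.

THE CONTROLLING DEVICE (new relative to every registered line; census CONTROL-CENSUS.md §g4, C27–C35).  Keep the designated relay FIXED and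
take as potential the block-goodness slack itself,
`K_S^d(u) := μ(⋃S↔b) + Σ_{W∩A=∅} μ(K_S=W)·μ(sel W ↔ b off W) − μ(d↔b) − μ(d↮b, d↔S, S↔b)`  (`K ≥ 0` is block goodness BG, selection form),
and move the WEIGHTING, not the block: for a fixed selection `K_S^d(u)` is AFFINE in every single edge weight, and both endpoint instances are
again block-goodness instances —
* PORT `f = s(x,z)`, `x ∈ S`, `z ∉ S`:  `K_S(u) = (1 − p_f)·K_S(u[f↦0]) + p_f·K_{S∪z}(u[f↦0])`  (the pocket factor never sees `f`: `x ∈ W`);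
* FAR edge `e` (both ends outside `S`):  `K_S(u) = (1 − p_e)·K_S(u[e↦0]) + p_e·K_S(u[e↦1])`;
* SURE port (`u f = 1`):  `K_S(u) = K_{S∪z}(u)`  (BG does not see weights internal to the block);
* RE-DESIGNATION:  `K^d − K^{d'} = τ̃(d') − τ̃(d)`  (glued reliabilities).
So `K` is a MARTINGALE under revealing edges one at a time — KN Thm 4's σ-linearity taken ONE EDGE at a time and iterated on the GROWING block —
and BG at the root follows from BG at the leaves of ANY finite revelation tree (deletion/contraction "factoring" as in network reliability).
Three kinds of leaves are certified by LANDED theorems: `b ∈ S`; KN Lemma 5 in the CURRENT weighting (`blockGood_leaf_lemma5`: some `v ∈ S`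
is at least as reliable as `d`); NO GLUED DRIFT (`d` minimises the glued reliabilities: `blockGood_leaf_ih` + point induction hypothesis,
trivial when `S` meets `A`).  `PeelDerivable A b d u S` below is exactly this inductive family of DERIVATION TREES (Type-valued data, so that provers can recurse on it and the tree audit does not read it as a proposition); `stub_peelSound` (M) is the four identities +
the three leaves; the load-bearing stub `stub_peelExists` (L) is the EDGE-PEELING CONJECTURE: every bad block at the un-glued minimiser admits a
derivation.

NUMERICAL EVIDENCE (own exact engine + backtracking solver, `lab/eng.py`, `lab/spc.py::EPC` of the g4 folder; 2^m enumeration, n ≤ 9):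
derivable in 209 + 255 + 880 random bad glued-drift PAIRS (n ≤ 7), 69 (n = 8), 244 + 259 TRIPLES, 129 + 79 QUADRUPLES, and in the adversarial
corpora (hill-climbs toward one-step-stuck states, toward greedy-order failure, toward solver failure); depth ≤ 10.  The obvious sub-calculi are
NOT complete — ports only (designation fixed) fails on an n = 8 adversarial instance that needs ONE far deletion (on the dethroning competitor's edge
to `b`) or a re-designation; "kill a port keeping `d` minimal" fails at a descendant of the same instance; no greedy order works — so the content
of `stub_peelExists` is the ORDER of revelation (an invariant surviving the all-deleted branch), not an inequality.  Canonical-strategy candidate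
(census C36, solver `qdesig2.py::QSC`, derives every instance tested): ports only, plus a switch to the block's Q-designation
`d_S = argmin_A τ_{u − E(S)}` (all ports removed — KN's Question-9 designation for the BLOCK) when glued-allowed; at `d_S` the all-deleted
branch is a `nodrift` leaf for free because port deletions do not touch `u − E(S)`.  The affinity identities are
verified to 3e-15 (300 graphs × every edge); pair goodness itself 0 violations / 26 570.

WHY IT DODGES THE STUCK GOAL of `peel` / `ratio_star` (`stub_pairGamma` / `stub_conePeel`, double-drift sub-case after revealing x's whole star
and re-minimising): nothing is divided, no star is revealed at once, the designation is never re-minimised (only the monotone `redesignate` rule),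
and the step is exact — the double drift is the all-deleted branch meeting a dethroned designation, which the data say is always avoidable by
re-ordering.  The cone/pair frontier `A.card = 4` (double-hit defect) is not met: pockets are never expanded, only their exact affinity is used.

Composition: `stub_peelExists ∧ stub_peelSound ⟹ hres9` (the residual kernel WITH the Q9 induction hypothesis, verbatim from
`additiveGluing_of_residualKernelQ9`, landed xfam-a) `⟹ AdditiveGluing` — real proofs `residualKernelQ9_of_peelCalculus`, `AdditiveGluing_of`,
`additiveGluing_closed` below.  Honours `additiveGluing_false_without_relay` (Disproof.lean): the root designation is the un-glued minimiser
(`hmin`, `hbad` are consumed by `stub_peelExists`; at an arbitrary designation the root itself can violate BG — the lead's 7-vertex witness — and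
no derivation exists); `additiveGluing_false_without_nonneg` is consumed upstream in `additiveGluing_of_residualKernelQ9`.
Nearest prior art for the METHOD: decision-tree (OSSS-style adaptive revelation) proofs of connection inequalities on GENERAL graphs
(Gladkov 2024, arXiv:2408.08457, Thms 1.1–1.3, which names the KN inequality as a target; Gladkov–Zimin 2024), Russo's formula / pivotality
(Grimmett 1999 §2.4), KN Thm 4 (σ-linearity), and factoring proofs of reliability / spanning-tree inequalities (Gross–Saccoman–Suffel 2013,
Thm 3.9).  Delta: here the queried edge MOVES THE GLUING BLOCK (the contraction child grows `S`), node semantics are exact identities of the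
gluing slack rather than couplings, and the leaves are certified stopping rules — a proof-search calculus for block goodness.
[cite: KozmaNitzan2024, §3.2 Definition p. 12, Lemma 5 p. 13, Thms 4–5 pp. 12–14, Question 9 p. 36]
-/

namespace Summit.CriticalPhenomena.PercolationContinuityZ3.Cruxes.AdditiveGluing.Starpeel

open MeasureTheory Set
open Literature.Probability.LatticeModels (prodBernoulli)
open Literature.Probability.Percolation (BondConfig openConn openConnIn openGraph openCluster)
open Summit.CriticalPhenomena.PercolationContinuityZ3.Theorems
open scoped BigOperators Classical

noncomputable section

/-! ## The derivation predicate -/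

/-- **Edge-peeling derivations** of block goodness for the block `S` in the weighting `u`, relays `A`, target `b`,
designated relay (index) `a₀`.  Three certified LEAVES and three sound STEPS; every step is an exact identity or a monotone
comparison of the block-goodness slack `K_S^{a}(u) = μ(⋃S↔b) + pockets − glued reliability of a`, so a derivation proves
`K ≥ 0` once the leaves are known non-negative (`stub_peelSound`).  [cite: KozmaNitzan2024, §3.2 Thm 4 (σ-linearity) p. 12,
Lemma 5 p. 13] -/
inductive PeelDerivable {n : ℕ} (A : Finset (Fin n)) (b : Fin n) :
    Fin n → (Sym2 (Fin n) → unitInterval) → Finset (Fin n) → Type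
  /-- leaf: the block has absorbed the target. -/
  | absorb (a₀ : Fin n) (u : Sym2 (Fin n) → unitInterval) (S : Finset (Fin n)) (hb : b ∈ S) : PeelDerivable A b a₀ u S
  /-- leaf (KN Lemma 5, `blockGood_leaf_lemma5`): some block vertex is at least as reliable as the designated relay NOW. -/
  | lemma5 (a₀ : Fin n) (u : Sym2 (Fin n) → unitInterval) (S : Finset (Fin n)) (v : Fin n) (hv : v ∈ S)
      (hle : (prodBernoulli u).real (openConn a₀ b) ≤ (prodBernoulli u).real (openConn v b)) :
      PeelDerivable A b a₀ u S
  /-- leaf (no glued drift, `blockGood_leaf_ih` + point IH): the designated relay minimises the GLUED reliabilities. -/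
  | nodrift (a₀ : Fin n) (u : Sym2 (Fin n) → unitInterval) (S : Finset (Fin n))
      (hgl : ∀ a ∈ A,
        (prodBernoulli u).real (openConn a₀ b)
            + (prodBernoulli u).real ((openConn a₀ b)ᶜ ∩ (⋃ s ∈ S, openConn a₀ s) ∩ (⋃ s ∈ S, openConn s b))
          ≤ (prodBernoulli u).real (openConn a b)
              + (prodBernoulli u).real ((openConn a b)ᶜ ∩ (⋃ s ∈ S, openConn a s) ∩ (⋃ s ∈ S, openConn s b))) :
      PeelDerivable A b a₀ u S
  /-- step (PORT = star edge `s(x,z)`, `x ∈ S`, `z ∉ S`): both sides of BG are affine in `u s(x,z)`; endpoint instances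
  `(u[f↦0], S)` and `(u[f↦0], insert z S)`.  Only edges of positive weight are peeled, so the positive-degree vertices of the
  children's glued graphs are among those of `u/S` (this is what lets the point induction hypothesis descend). -/
  | port (a₀ : Fin n) (u : Sym2 (Fin n) → unitInterval) (S : Finset (Fin n)) (x z : Fin n) (hx : x ∈ S) (hz : z ∉ S)
      (hp : 0 < (u s(x, z) : ℝ))
      (h0 : PeelDerivable A b a₀ (Function.update u s(x, z) 0) S)
      (h1 : PeelDerivable A b a₀ (Function.update u s(x, z) 0) (insert z S)) :
      PeelDerivable A b a₀ u S
  /-- step (SURE PORT): a weight-one star edge `s(x,z)` is internal to `insert z S`, and block goodness does not see internal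
  weights, so the grown block suffices (this is what edge CONTRACTION means for the block). -/
  | portSure (a₀ : Fin n) (u : Sym2 (Fin n) → unitInterval) (S : Finset (Fin n)) (x z : Fin n) (hx : x ∈ S) (hz : z ∉ S)
      (h1 : (u s(x, z) : ℝ) = 1) (h : PeelDerivable A b a₀ u (insert z S)) :
      PeelDerivable A b a₀ u S
  /-- step (FAR edge `s(y₁,y₂)`, both ends outside `S`): both sides of BG (fixed selection) are affine in `u s(y₁,y₂)`;
  endpoint instances `(u[e↦0], S)` and `(u[e↦1], S)`. -/
  | far (a₀ : Fin n) (u : Sym2 (Fin n) → unitInterval) (S : Finset (Fin n)) (y₁ y₂ : Fin n)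
      (hy₁ : y₁ ∉ S) (hy₂ : y₂ ∉ S) (hne : y₁ ≠ y₂) (hp : 0 < (u s(y₁, y₂) : ℝ))
      (h0 : PeelDerivable A b a₀ (Function.update u s(y₁, y₂) 0) S)
      (h1 : PeelDerivable A b a₀ (Function.update u s(y₁, y₂) 1) S) :
      PeelDerivable A b a₀ u S
  /-- step (RE-DESIGNATION): block goodness at a relay `a₁` whose glued reliability is at least that of `a₀` gives it at `a₀`. -/
  | redesignate (a₀ a₁ : Fin n) (u : Sym2 (Fin n) → unitInterval) (S : Finset (Fin n)) (ha₁ : a₁ ∈ A)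
      (hle : (prodBernoulli u).real (openConn a₀ b)
            + (prodBernoulli u).real ((openConn a₀ b)ᶜ ∩ (⋃ s ∈ S, openConn a₀ s) ∩ (⋃ s ∈ S, openConn s b))
          ≤ (prodBernoulli u).real (openConn a₁ b)
              + (prodBernoulli u).real ((openConn a₁ b)ᶜ ∩ (⋃ s ∈ S, openConn a₁ s) ∩ (⋃ s ∈ S, openConn s b)))
      (h1 : PeelDerivable A b a₁ u S) :
      PeelDerivable A b a₀ u S

/-! ## THE STUBS -/

/-- **STUB `stub_peelExists` (load-bearing: the EDGE-PEELING CONJECTURE).**  Every block `S` of at least two BAD non-relays, at a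
minimiser `a₀` of the un-glued reliabilities, with at least three relays besides the target, admits an edge-peeling derivation (no drift
hypothesis needed: a drift-free block is the leaf `nodrift`).  A finite one-player reachability game with exact semantics; every move strictly
decreases (lexicographically) the numbers of positive and of fractional edge weights.  Exact numerics: solvable in > 2 100 random instances
(pairs / triples / quadruples, n ≤ 9) and in every adversarial instance produced; ports-only, min-keeping and greedy sub-strategies are each
refuted (CONTROL-CENSUS C31–C34), so the proof must supply an invariant for the ORDER of revelation.
[cite: KozmaNitzan2024, §3.2 Thms 4–5 pp. 12–14, Lemma 5 p. 13, Question 9 p. 36] -/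
theorem stub_peelExists :
    ∀ (n : ℕ) (u : Sym2 (Fin n) → unitInterval) (A S : Finset (Fin n)) (b a₀ : Fin n),
      b ∈ A → Disjoint S A → 2 ≤ S.card → 4 ≤ A.card → a₀ ∈ A →
      (∀ a ∈ A, (prodBernoulli u).real (openConn a₀ b) ≤ (prodBernoulli u).real (openConn a b)) →
      (∀ v ∈ S, (prodBernoulli u).real (openConn v b) < (prodBernoulli u).real (openConn a₀ b)) →
      Nonempty (PeelDerivable A b a₀ u S) := by
  sorry

/-- **STUB `stub_peelSound` (soundness of derivations; M-sized, every ingredient landed).**  Induction on the derivation: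
`absorb` — `b ∈ S` makes `μ(⋃ S↔b) = 1 ≥` the glued reliability; `lemma5` — `blockGood_leaf_lemma5`; `nodrift` — if `S` meets `A` the glued
reliability of that relay is at most `μ(⋃ S↔b)`, else `blockGood_leaf_ih` with the point hypothesis below (glued minimality in the glued weighting
= `hgl` via `blockGrowth_glue_real_openConn`, point goodness via `good_of_q9`); `port` / `far` — both sides of BG are affine in the edge weight
(`real_update_affine` event by event; in the pocket products one factor is constant) with the two children as endpoint instances (endpoint
identifications for `⋃_{v∈S} v↔t`, for the block-cluster event, and for the glued reliability AS A WHOLE); `portSure` — BG does not depend on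
weights internal to `insert z S`; `redesignate` — subtract `hle`.  The induction hypothesis passes to children because the positive-degree count
of `(u[f↦c])/(S')` (`S' ⊇ S`) is at most that of `u/S`.
[cite: KozmaNitzan2024, §3.2 Thm 4 p. 12, Lemma 5 p. 13] -/
theorem stub_peelSound :
    ∀ (n : ℕ) (u : Sym2 (Fin n) → unitInterval) (A S : Finset (Fin n)) (b a₀ : Fin n)
      (sel : Finset (Fin n) → Fin n),
      b ∈ A → a₀ ∈ A → (∀ W, sel W ∈ A) → 2 ≤ S.card →
      PeelDerivable A b a₀ u S →
      (∀ w' : Sym2 (Fin n) → unitInterval,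
        (Finset.univ.filter (fun v : Fin n => ∃ z : Fin n, 0 < (w' s(z, v) : ℝ))).card ≤
          (Finset.univ.filter (fun v : Fin n => ∃ z : Fin n,
            0 < ((fun e : Sym2 (Fin n) => if (∀ x ∈ e, x ∈ S) ∧ ¬ e.IsDiag then 1 else u e) s(z, v) : ℝ))).card →
        ∀ (A' : Finset (Fin n)) (o' b' : Fin n), b' ∈ A' → o' ∉ A' →
        ∀ c₀ : Fin n, c₀ ∈ A' →
          (∀ c ∈ A', (prodBernoulli (fun e : Sym2 (Fin n) => if o' ∈ e then (0 : unitInterval) else w' e)).real (openConn c₀ b') ≤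
            (prodBernoulli (fun e : Sym2 (Fin n) => if o' ∈ e then (0 : unitInterval) else w' e)).real (openConn c b')) →
          ∀ sel' : Finset (Fin n) → Fin n, (∀ W', sel' W' ∈ A') →
          (prodBernoulli w').real (openConn c₀ b') ≤
            (prodBernoulli w').real (openConn o' b')
              + ∑ W' ∈ (Finset.univ : Finset (Finset (Fin n))).filter (fun W' => o' ∈ W' ∧ Disjoint W' A'),
                  (prodBernoulli w').real {ω : BondConfig (Fin n) | openCluster ω o' = (W' : Set (Fin n))}
                    * (prodBernoulli w').real (openConnIn ((W' : Set (Fin n))ᶜ) (sel' W') b')) →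
      (prodBernoulli u).real (openConn a₀ b)
          + (prodBernoulli u).real ((openConn a₀ b)ᶜ ∩ (⋃ s ∈ S, openConn a₀ s) ∩ (⋃ s ∈ S, openConn s b))
        ≤ (prodBernoulli u).real (⋃ s ∈ S, openConn s b)
          + ∑ W ∈ (Finset.univ : Finset (Finset (Fin n))).filter (fun W => Disjoint W A),
              (prodBernoulli u).real {ω : BondConfig (Fin n) | ∀ z : Fin n, (z ∈ W ↔ ω ∈ ⋃ s ∈ S, openConn s z)}
                * (prodBernoulli u).real (openConnIn ((W : Set (Fin n))ᶜ) (sel W) b) := by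
  sorry

/-! ## Real proofs: the composition -/

/-- The residual kernel with the Q9 induction hypothesis (`hres9` of `additiveGluing_of_residualKernelQ9`, verbatim) from the two
stubs: existence gives a derivation of the bad block at the un-glued minimiser, soundness turns it into block goodness. -/
theorem residualKernelQ9_of_peelCalculus
    (hA : ∀ (n : ℕ) (u : Sym2 (Fin n) → unitInterval) (A S : Finset (Fin n)) (b a₀ : Fin n),
      b ∈ A → Disjoint S A → 2 ≤ S.card → 4 ≤ A.card → a₀ ∈ A →
      (∀ a ∈ A, (prodBernoulli u).real (openConn a₀ b) ≤ (prodBernoulli u).real (openConn a b)) →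
      (∀ v ∈ S, (prodBernoulli u).real (openConn v b) < (prodBernoulli u).real (openConn a₀ b)) →
      Nonempty (PeelDerivable A b a₀ u S))
    (hB : ∀ (n : ℕ) (u : Sym2 (Fin n) → unitInterval) (A S : Finset (Fin n)) (b a₀ : Fin n)
      (sel : Finset (Fin n) → Fin n),
      b ∈ A → a₀ ∈ A → (∀ W, sel W ∈ A) → 2 ≤ S.card →
      PeelDerivable A b a₀ u S →
      (∀ w' : Sym2 (Fin n) → unitInterval,
        (Finset.univ.filter (fun v : Fin n => ∃ z : Fin n, 0 < (w' s(z, v) : ℝ))).card ≤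
          (Finset.univ.filter (fun v : Fin n => ∃ z : Fin n,
            0 < ((fun e : Sym2 (Fin n) => if (∀ x ∈ e, x ∈ S) ∧ ¬ e.IsDiag then 1 else u e) s(z, v) : ℝ))).card →
        ∀ (A' : Finset (Fin n)) (o' b' : Fin n), b' ∈ A' → o' ∉ A' →
        ∀ c₀ : Fin n, c₀ ∈ A' →
          (∀ c ∈ A', (prodBernoulli (fun e : Sym2 (Fin n) => if o' ∈ e then (0 : unitInterval) else w' e)).real (openConn c₀ b') ≤
            (prodBernoulli (fun e : Sym2 (Fin n) => if o' ∈ e then (0 : unitInterval) else w' e)).real (openConn c b')) →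
          ∀ sel' : Finset (Fin n) → Fin n, (∀ W', sel' W' ∈ A') →
          (prodBernoulli w').real (openConn c₀ b') ≤
            (prodBernoulli w').real (openConn o' b')
              + ∑ W' ∈ (Finset.univ : Finset (Finset (Fin n))).filter (fun W' => o' ∈ W' ∧ Disjoint W' A'),
                  (prodBernoulli w').real {ω : BondConfig (Fin n) | openCluster ω o' = (W' : Set (Fin n))}
                    * (prodBernoulli w').real (openConnIn ((W' : Set (Fin n))ᶜ) (sel' W') b')) →
      (prodBernoulli u).real (openConn a₀ b)
          + (prodBernoulli u).real ((openConn a₀ b)ᶜ ∩ (⋃ s ∈ S, openConn a₀ s) ∩ (⋃ s ∈ S, openConn s b))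
        ≤ (prodBernoulli u).real (⋃ s ∈ S, openConn s b)
          + ∑ W ∈ (Finset.univ : Finset (Finset (Fin n))).filter (fun W => Disjoint W A),
              (prodBernoulli u).real {ω : BondConfig (Fin n) | ∀ z : Fin n, (z ∈ W ↔ ω ∈ ⋃ s ∈ S, openConn s z)}
                * (prodBernoulli u).real (openConnIn ((W : Set (Fin n))ᶜ) (sel W) b)) :
    ∀ (n : ℕ) (u : Sym2 (Fin n) → unitInterval) (A S : Finset (Fin n)) (b a₀ : Fin n)
      (sel : Finset (Fin n) → Fin n),
      b ∈ A → Disjoint S A → 2 ≤ S.card → 4 ≤ A.card → (∀ W, sel W ∈ A) → a₀ ∈ A →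
      (∀ a ∈ A, (prodBernoulli u).real (openConn a₀ b) ≤ (prodBernoulli u).real (openConn a b)) →
      (∀ v ∈ S, (prodBernoulli u).real (openConn v b) < (prodBernoulli u).real (openConn a₀ b)) →
      (∃ a ∈ A, (prodBernoulli (fun e : Sym2 (Fin n) => if (∀ x ∈ e, x ∈ S) ∧ ¬ e.IsDiag then 1 else u e)).real (openConn a b) <
        (prodBernoulli (fun e : Sym2 (Fin n) => if (∀ x ∈ e, x ∈ S) ∧ ¬ e.IsDiag then 1 else u e)).real (openConn a₀ b)) →
      (∀ w' : Sym2 (Fin n) → unitInterval,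
        (Finset.univ.filter (fun v : Fin n => ∃ z : Fin n, 0 < (w' s(z, v) : ℝ))).card ≤
          (Finset.univ.filter (fun v : Fin n => ∃ z : Fin n,
            0 < ((fun e : Sym2 (Fin n) => if (∀ x ∈ e, x ∈ S) ∧ ¬ e.IsDiag then 1 else u e) s(z, v) : ℝ))).card →
        ∀ (A' : Finset (Fin n)) (o' b' : Fin n), b' ∈ A' → o' ∉ A' →
        ∀ c₀ : Fin n, c₀ ∈ A' →
          (∀ c ∈ A', (prodBernoulli (fun e : Sym2 (Fin n) => if o' ∈ e then (0 : unitInterval) else w' e)).real (openConn c₀ b') ≤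
            (prodBernoulli (fun e : Sym2 (Fin n) => if o' ∈ e then (0 : unitInterval) else w' e)).real (openConn c b')) →
          ∀ sel' : Finset (Fin n) → Fin n, (∀ W', sel' W' ∈ A') →
          (prodBernoulli w').real (openConn c₀ b') ≤
            (prodBernoulli w').real (openConn o' b')
              + ∑ W' ∈ (Finset.univ : Finset (Finset (Fin n))).filter (fun W' => o' ∈ W' ∧ Disjoint W' A'),
                  (prodBernoulli w').real {ω : BondConfig (Fin n) | openCluster ω o' = (W' : Set (Fin n))}
                    * (prodBernoulli w').real (openConnIn ((W' : Set (Fin n))ᶜ) (sel' W') b')) →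
      (prodBernoulli u).real (openConn a₀ b)
          + (prodBernoulli u).real ((openConn a₀ b)ᶜ ∩ (⋃ s ∈ S, openConn a₀ s) ∩ (⋃ s ∈ S, openConn s b))
        ≤ (prodBernoulli u).real (⋃ s ∈ S, openConn s b)
          + ∑ W ∈ (Finset.univ : Finset (Finset (Fin n))).filter (fun W => Disjoint W A),
              (prodBernoulli u).real {ω : BondConfig (Fin n) | ∀ z : Fin n, (z ∈ W ↔ ω ∈ ⋃ s ∈ S, openConn s z)}
                * (prodBernoulli u).real (openConnIn ((W : Set (Fin n))ᶜ) (sel W) b) := by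
  intro n u A S b a₀ sel hb hSA hS2 hA4 hsel ha₀ hmin hbad _hdrift hIH
  obtain ⟨t⟩ := hA n u A S b a₀ hb hSA hS2 hA4 ha₀ hmin hbad
  exact hB n u A S b a₀ sel hb ha₀ hsel hS2 t hIH

/-- **`AdditiveGluing` from the two stubs** (through the landed `additiveGluing_of_residualKernelQ9`, seat xfam-a). -/
theorem AdditiveGluing_of
    (hA : ∀ (n : ℕ) (u : Sym2 (Fin n) → unitInterval) (A S : Finset (Fin n)) (b a₀ : Fin n),
      b ∈ A → Disjoint S A → 2 ≤ S.card → 4 ≤ A.card → a₀ ∈ A →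
      (∀ a ∈ A, (prodBernoulli u).real (openConn a₀ b) ≤ (prodBernoulli u).real (openConn a b)) →
      (∀ v ∈ S, (prodBernoulli u).real (openConn v b) < (prodBernoulli u).real (openConn a₀ b)) →
      Nonempty (PeelDerivable A b a₀ u S))
    (hB : ∀ (n : ℕ) (u : Sym2 (Fin n) → unitInterval) (A S : Finset (Fin n)) (b a₀ : Fin n)
      (sel : Finset (Fin n) → Fin n),
      b ∈ A → a₀ ∈ A → (∀ W, sel W ∈ A) → 2 ≤ S.card →
      PeelDerivable A b a₀ u S →
      (∀ w' : Sym2 (Fin n) → unitInterval,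
        (Finset.univ.filter (fun v : Fin n => ∃ z : Fin n, 0 < (w' s(z, v) : ℝ))).card ≤
          (Finset.univ.filter (fun v : Fin n => ∃ z : Fin n,
            0 < ((fun e : Sym2 (Fin n) => if (∀ x ∈ e, x ∈ S) ∧ ¬ e.IsDiag then 1 else u e) s(z, v) : ℝ))).card →
        ∀ (A' : Finset (Fin n)) (o' b' : Fin n), b' ∈ A' → o' ∉ A' →
        ∀ c₀ : Fin n, c₀ ∈ A' →
          (∀ c ∈ A', (prodBernoulli (fun e : Sym2 (Fin n) => if o' ∈ e then (0 : unitInterval) else w' e)).real (openConn c₀ b') ≤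
            (prodBernoulli (fun e : Sym2 (Fin n) => if o' ∈ e then (0 : unitInterval) else w' e)).real (openConn c b')) →
          ∀ sel' : Finset (Fin n) → Fin n, (∀ W', sel' W' ∈ A') →
          (prodBernoulli w').real (openConn c₀ b') ≤
            (prodBernoulli w').real (openConn o' b')
              + ∑ W' ∈ (Finset.univ : Finset (Finset (Fin n))).filter (fun W' => o' ∈ W' ∧ Disjoint W' A'),
                  (prodBernoulli w').real {ω : BondConfig (Fin n) | openCluster ω o' = (W' : Set (Fin n))}
                    * (prodBernoulli w').real (openConnIn ((W' : Set (Fin n))ᶜ) (sel' W') b')) →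
      (prodBernoulli u).real (openConn a₀ b)
          + (prodBernoulli u).real ((openConn a₀ b)ᶜ ∩ (⋃ s ∈ S, openConn a₀ s) ∩ (⋃ s ∈ S, openConn s b))
        ≤ (prodBernoulli u).real (⋃ s ∈ S, openConn s b)
          + ∑ W ∈ (Finset.univ : Finset (Finset (Fin n))).filter (fun W => Disjoint W A),
              (prodBernoulli u).real {ω : BondConfig (Fin n) | ∀ z : Fin n, (z ∈ W ↔ ω ∈ ⋃ s ∈ S, openConn s z)}
                * (prodBernoulli u).real (openConnIn ((W : Set (Fin n))ᶜ) (sel W) b)) :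
    Summit.CriticalPhenomena.PercolationContinuityZ3.Theses.PercNearOneGluing.AdditiveGluing :=
  additiveGluing_of_residualKernelQ9 (residualKernelQ9_of_peelCalculus hA hB)

/-- **The crux BY NAME from the registered stubs** (the skeleton theorem). -/
theorem additiveGluing_closed :
    Summit.CriticalPhenomena.PercolationContinuityZ3.Theses.PercNearOneGluing.AdditiveGluing :=
  AdditiveGluing_of stub_peelExists stub_peelSound

end

end Summit.CriticalPhenomena.PercolationContinuityZ3.Cruxes.AdditiveGluing.Starpeel
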